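import Summits.BirchSwinnertonDyer.Rank1Residual.Additive.X3BranchKummerLayerCubeAtThree
import HarnessLib

/-!
# X3, the DEGENERATE rows OFF the sub-locus, HIGHER LAYERS: the LOCAL CUBE CONDITION AT `3` for an
# arbitrary MULTIPLICATION TABLE — `1 + 9t` has a cube root fixed by the decomposition group elements
# fixing `θ`, for `t ∈ ℤ[θ]` and ANY algebraic integer `θ` with a given structure-constant table
# `θ^i θ^j = Σ_k μ_{kij} θ^k` (cell `bsd-eis`, seat `bsd-eis-x3` gen 8; the `n`-dimensional version of gen 7's
# `X3BranchKummerLayerCubeAtThree.lean` (there `n = 3`, coordinates written out), needed for the layers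
# `ℚ_2 = ℚ(θ₂)` (`n = 9`), `ℚ_3` (`n = 27`), … of x3-MEMO-10 §5 (c); route K1 `AdditiveBranchIMC`, crux
# `GordTwoRankZeroOffCaseOne` — supports only)

HONEST FRAMING (`run/shared/lean/pub/bsd-eis/README.md` §4): THEOREMS ONLY (no `def`, no named fact,
no `sorry`); nothing is booked; no label, tier or count of record moves.

* §1 `exists_fixedPoint_cubeEq_table` — for `μ : Fin n → Fin n → Fin n → ℤ` and `t ∈ ℤ₃ⁿ` there is
  `s ∈ ℤ₃ⁿ` with `s_k + 3(sq(s)_k + cb(s)_k) = t_k`, `sq(s)_k = Σ_{ij} μ_{kij} s_i s_j`,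
  `cb(s)_k = Σ_{ij} μ_{kij} sq(s)_i s_j` (Banach: `s ↦ t − 3(sq + cb)` contracts `ℤ₃ⁿ` by `‖3‖₃`, the
  coordinates being integral polynomials — `norm_bilin_sub_le`); `sum_mul_sum_eq_table`;
* §2 `exists_cube_eq_of_table` — along `φ : ℤ₃ → L` with `T ∈ L`, `T^iT^j = Σ_k μ_{kij} T^k`:
  `(1 + 3 Σ_k φ(s_k) T^k)³ = 1 + 9 Σ_k t_k T^k`;
* §3 `exists_cubeRoot_smul_eq_self_of_decomp_table` — in `ℚ̄`: for `θ` with `θ^iθ^j = Σ_k μ_{kij} θ^k`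
  some cube root of `1 + 9 Σ_k t_k θ^k` is fixed by every `σ ∈ D_v` (`v ∣ 3`) with `σθ = θ` (root
  matching through the tree's `ι : ℚ̄ → \bar{ℚ_v}` exactly as gen 7).
References: [Cassels1986] Ch. 4 Lemma 3.1 (method); [SerreLocalFields1979] Ch. II §4;
[NeukirchANT1999] Ch. II (9.6).
-/

set_option autoImplicit false

noncomputable section

open scoped Classical NumberField

namespace Summit.BirchSwinnertonDyer.Rank1Residual.Additive

namespace KummerLayerClasses

open NumberField IsDedekindDomain Field Metric Finset
  Literature.NumberTheory.GaloisRepresentations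
  Literature.NumberTheory.EllipticCurves
  Literature.NumberTheory.EllipticCurves.GreenbergSelmer

/-! ### §1 The contraction on `ℤ₃ⁿ` -/

section Contraction

variable {n : ℕ}

/-- **The bilinear coordinates are `1`-Lipschitz**: for `x, x', y, y' ∈ ℤ₃ⁿ`,
`‖Σ_{ij} μ_{ij} x_i x'_j − Σ_{ij} μ_{ij} y_i y'_j‖ ≤ max (dist x y) (dist x' y')` (ultrametric inequality;
every entry of `ℤ₃` has norm `≤ 1`). [folklore] -/
theorem norm_bilin_sub_le (μ : Fin n → Fin n → ℤ) (x x' y y' : Fin n → ℤ_[3]) :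
    ‖(∑ i, ∑ j, (μ i j : ℤ_[3]) * x i * x' j) - ∑ i, ∑ j, (μ i j : ℤ_[3]) * y i * y' j‖ ≤
      max (dist x y) (dist x' y') := by
  have hsplit : (∑ i, ∑ j, (μ i j : ℤ_[3]) * x i * x' j) - ∑ i, ∑ j, (μ i j : ℤ_[3]) * y i * y' j =
      ∑ i, ∑ j, ((μ i j : ℤ_[3]) * (x i - y i) * x' j + (μ i j : ℤ_[3]) * y i * (x' j - y' j)) := by
    rw [← Finset.sum_sub_distrib]
    refine Finset.sum_congr rfl fun i _ ↦ ?_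
    rw [← Finset.sum_sub_distrib]
    exact Finset.sum_congr rfl fun j _ ↦ by ring
  rw [hsplit]
  have hd : 0 ≤ max (dist x y) (dist x' y') := le_max_of_le_left dist_nonneg
  refine IsUltrametricDist.norm_sum_le_of_forall_le_of_nonneg hd fun i _ ↦
    IsUltrametricDist.norm_sum_le_of_forall_le_of_nonneg hd fun j _ ↦ ?_
  refine (PadicInt.nonarchimedean _ _).trans (max_le_max ?_ ?_)
  · rw [norm_mul, norm_mul]
    calc ‖(μ i j : ℤ_[3])‖ * ‖x i - y i‖ * ‖x' j‖ ≤ 1 * ‖x i - y i‖ * 1 := by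
          gcongr
          · exact PadicInt.norm_le_one _
          · exact PadicInt.norm_le_one _
      _ = dist (x i) (y i) := by rw [one_mul, mul_one, dist_eq_norm]
      _ ≤ dist x y := dist_le_pi_dist x y i
  · rw [norm_mul, norm_mul]
    calc ‖(μ i j : ℤ_[3])‖ * ‖y i‖ * ‖x' j - y' j‖ ≤ 1 * 1 * ‖x' j - y' j‖ := by
          gcongr
          · exact PadicInt.norm_le_one _
          · exact PadicInt.norm_le_one _
      _ = dist (x' j) (y' j) := by rw [one_mul, one_mul, dist_eq_norm]
      _ ≤ dist x' y' := dist_le_pi_dist x' y' j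

/-- **`s_k + 3(sq(s)_k + cb(s)_k) = t_k` is solvable in `ℤ₃ⁿ`** for any integer table `μ` (Banach fixed
point of `s ↦ t − 3(sq(s) + cb(s))`, a `3⁻¹`-contraction of the complete space `ℤ₃ⁿ`).
[cite: Cassels1986, Ch. 4 Lemma 3.1 (method)] [cite: SerreLocalFields1979, Ch. II §4 Prop. 8 (method)] -/
theorem exists_fixedPoint_cubeEq_table (μ : Fin n → Fin n → Fin n → ℤ) (t : Fin n → ℤ_[3]) :
    ∃ s : Fin n → ℤ_[3], ∀ k,
      s k + 3 * ((∑ i, ∑ j, (μ k i j : ℤ_[3]) * s i * s j) +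
        ∑ i, ∑ j, (μ k i j : ℤ_[3]) * (∑ i', ∑ j', (μ i i' j' : ℤ_[3]) * s i' * s j') * s j) = t k := by
  let sq : (Fin n → ℤ_[3]) → (Fin n → ℤ_[3]) := fun x k ↦ ∑ i, ∑ j, (μ k i j : ℤ_[3]) * x i * x j
  let cb : (Fin n → ℤ_[3]) → (Fin n → ℤ_[3]) := fun x k ↦ ∑ i, ∑ j, (μ k i j : ℤ_[3]) * sq x i * x j
  let Φ : (Fin n → ℤ_[3]) → (Fin n → ℤ_[3]) := fun x k ↦ t k - 3 * (sq x k + cb x k)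
  have h3 : ‖(3 : ℤ_[3])‖ = (3 : ℝ)⁻¹ := by
    have := @PadicInt.norm_p 3 _
    exact_mod_cast this
  have hsq : ∀ x y : Fin n → ℤ_[3], dist (sq x) (sq y) ≤ dist x y := by
    intro x y
    refine (dist_pi_le_iff dist_nonneg).mpr fun k ↦ ?_
    rw [dist_eq_norm]
    exact (norm_bilin_sub_le (μ k) x x y y).trans (max_le le_rfl le_rfl)
  have hcb : ∀ x y : Fin n → ℤ_[3], dist (cb x) (cb y) ≤ dist x y := by
    intro x y
    refine (dist_pi_le_iff dist_nonneg).mpr fun k ↦ ?_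
    rw [dist_eq_norm]
    exact (norm_bilin_sub_le (μ k) (sq x) x (sq y) y).trans (max_le (hsq x y) le_rfl)
  have hLip : ∀ x y, dist (Φ x) (Φ y) ≤ ((3⁻¹ : NNReal) : ℝ) * dist x y := by
    intro x y
    have hK : ((3⁻¹ : NNReal) : ℝ) = (3 : ℝ)⁻¹ := by simp
    rw [hK]
    refine (dist_pi_le_iff (by positivity)).mpr fun k ↦ ?_
    rw [dist_eq_norm]
    have e : Φ x k - Φ y k = 3 * ((sq y k - sq x k) + (cb y k - cb x k)) := by
      simp only [Φ]; ring
    rw [e, norm_mul, h3]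
    refine mul_le_mul_of_nonneg_left ?_ (by norm_num)
    refine (PadicInt.nonarchimedean _ _).trans (max_le ?_ ?_)
    · rw [← dist_eq_norm, dist_comm]; exact (dist_le_pi_dist _ _ k).trans (hsq x y)
    · rw [← dist_eq_norm, dist_comm]; exact (dist_le_pi_dist _ _ k).trans (hcb x y)
  have hΦ : ContractingWith (3⁻¹ : NNReal) Φ :=
    ⟨by rw [NNReal.inv_lt_one_iff (by norm_num)]; norm_num, LipschitzWith.of_dist_le_mul hLip⟩
  set x := ContractingWith.fixedPoint Φ hΦ with hx
  have hfix : Φ x = x := ContractingWith.fixedPoint_isFixedPt hΦ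
  refine ⟨x, fun k ↦ ?_⟩
  have e := congrFun hfix k
  simp only [Φ, cb, sq] at e
  linear_combination -e

end Contraction

/-! ### §2 Transport along `ℤ₃ → L`: `(1 + 3S)³ = 1 + 9t` from the table -/

section Transport

variable {n : ℕ}

/-- Products of two table sums: `(Σ_i a_i T^i)(Σ_j b_j T^j) = Σ_k (Σ_{ij} μ_{kij} a_i b_j) T^k` when
`T^i T^j = Σ_k μ_{kij} T^k`. [folklore] -/
theorem sum_mul_sum_eq_table {L : Type*} [CommRing L] (μ : Fin n → Fin n → Fin n → ℤ) (T : L)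
    (hT : ∀ i j : Fin n, T ^ (i : ℕ) * T ^ (j : ℕ) = ∑ k, (μ k i j : L) * T ^ (k : ℕ))
    (a b : Fin n → L) :
    (∑ i, a i * T ^ (i : ℕ)) * (∑ j, b j * T ^ (j : ℕ)) =
      ∑ k, (∑ i, ∑ j, (μ k i j : L) * a i * b j) * T ^ (k : ℕ) := by
  calc (∑ i, a i * T ^ (i : ℕ)) * (∑ j, b j * T ^ (j : ℕ))
      = ∑ i, ∑ j, a i * b j * (T ^ (i : ℕ) * T ^ (j : ℕ)) := by
        rw [Finset.sum_mul]
        refine Finset.sum_congr rfl fun i _ ↦ ?_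
        rw [Finset.mul_sum]
        exact Finset.sum_congr rfl fun j _ ↦ by ring
    _ = ∑ i, ∑ j, ∑ k, (μ k i j : L) * a i * b j * T ^ (k : ℕ) := by
        refine Finset.sum_congr rfl fun i _ ↦ Finset.sum_congr rfl fun j _ ↦ ?_
        rw [hT, Finset.mul_sum]
        exact Finset.sum_congr rfl fun k _ ↦ by ring
    _ = ∑ i, ∑ k, ∑ j, (μ k i j : L) * a i * b j * T ^ (k : ℕ) :=
        Finset.sum_congr rfl fun i _ ↦ Finset.sum_comm
    _ = ∑ k, ∑ i, ∑ j, (μ k i j : L) * a i * b j * T ^ (k : ℕ) := Finset.sum_comm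
    _ = ∑ k, (∑ i, ∑ j, (μ k i j : L) * a i * b j) * T ^ (k : ℕ) := by
        refine Finset.sum_congr rfl fun k _ ↦ ?_
        rw [Finset.sum_mul]
        exact Finset.sum_congr rfl fun i _ ↦ by rw [Finset.sum_mul]

/-- **`1 + 9 Σ_k t_k T^k` is a cube in any `ℤ₃`-algebra with an element `T` obeying the table**:
with `s ∈ ℤ₃ⁿ` from `exists_fixedPoint_cubeEq_table` pushed along `φ : ℤ₃ → L`,
`(1 + 3 Σ_k φ(s_k) T^k)³ = 1 + 9 Σ_k t_k T^k` (`(1 + 3S)³ = 1 + 9(S + 3S² + 3S³)`).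
[cite: SerreLocalFields1979, Ch. II §4 Prop. 8 (method)] -/
theorem exists_cube_eq_of_table {L : Type*} [CommRing L] (φ : ℤ_[3] →+* L)
    (μ : Fin n → Fin n → Fin n → ℤ) (T : L)
    (hT : ∀ i j : Fin n, T ^ (i : ℕ) * T ^ (j : ℕ) = ∑ k, (μ k i j : L) * T ^ (k : ℕ))
    (t : Fin n → ℤ) :
    ∃ s : Fin n → ℤ_[3], (1 + 3 * ∑ k, φ (s k) * T ^ (k : ℕ)) ^ 3 =
      1 + 9 * ∑ k, (t k : L) * T ^ (k : ℕ) := by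
  obtain ⟨s, hs⟩ := exists_fixedPoint_cubeEq_table μ (fun k ↦ (t k : ℤ_[3]))
  refine ⟨s, ?_⟩
  set S : L := ∑ k, φ (s k) * T ^ (k : ℕ) with hSdef
  -- `S² = Σ φ(sq_k) T^k`, `S³ = Σ φ(cb_k) T^k`
  have hS2 : S * S = ∑ k, φ (∑ i, ∑ j, (μ k i j : ℤ_[3]) * s i * s j) * T ^ (k : ℕ) := by
    rw [hSdef, sum_mul_sum_eq_table μ T hT]
    refine Finset.sum_congr rfl fun k _ ↦ ?_
    congr 1
    simp only [map_sum, map_mul, map_intCast]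
  have hS3 : S * S * S = ∑ k, φ (∑ i, ∑ j, (μ k i j : ℤ_[3]) *
      (∑ i', ∑ j', (μ i i' j' : ℤ_[3]) * s i' * s j') * s j) * T ^ (k : ℕ) := by
    rw [hS2, hSdef, sum_mul_sum_eq_table μ T hT]
    refine Finset.sum_congr rfl fun k _ ↦ ?_
    congr 1
    simp only [map_sum, map_mul, map_intCast]
  -- `S + 3S² + 3S³ = Σ t_k T^k`
  have hsum : S + 3 * (S * S) + 3 * (S * S * S) = ∑ k, (t k : L) * T ^ (k : ℕ) := by
    rw [hS3, hS2, hSdef, Finset.mul_sum, Finset.mul_sum, ← Finset.sum_add_distrib,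
      ← Finset.sum_add_distrib]
    refine Finset.sum_congr rfl fun k _ ↦ ?_
    have e := congrArg φ (hs k)
    rw [map_intCast] at e
    rw [← e]
    simp only [map_add, map_mul, map_ofNat]
    ring
  calc (1 + 3 * S) ^ 3 = 1 + 9 * (S + 3 * (S * S) + 3 * (S * S * S)) := by ring
    _ = 1 + 9 * ∑ k, (t k : L) * T ^ (k : ℕ) := by rw [hsum]

end Transport

/-! ### §3 Back to `ℚ̄`: a cube root fixed by the decomposition group elements fixing `θ` -/

section Decomp

variable {n : ℕ}

/-- **The local condition at `3` over a layer given by a table.** `θ ∈ ℚ̄` with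
`θ^i θ^j = Σ_k μ_{kij} θ^k` (`i, j < n`), `t ∈ ℤⁿ`, `v` the place of `ℚ` at `3`: some cube root `β'` of
`1 + 9 Σ_k t_k θ^k` in `ℚ̄` is fixed by every `σ ∈ D_v` with `σθ = θ` — §2 along
`ℤ₃ → ℚ₃ ≃ ℚ_v → \bar{ℚ_v}` and gen 6/7's root matching through `ι : ℚ̄ → \bar{ℚ_v}`.
[cite: NeukirchANT1999, Ch. II (9.6)] [cite: Cassels1986, Ch. 4 Lemma 3.1] -/
theorem exists_cubeRoot_smul_eq_self_of_decomp_table {θ : AlgebraicClosure ℚ}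
    (μ : Fin n → Fin n → Fin n → ℤ)
    (hθ : ∀ i j : Fin n, θ ^ (i : ℕ) * θ ^ (j : ℕ) = ∑ k, (μ k i j : AlgebraicClosure ℚ) * θ ^ (k : ℕ))
    (t : Fin n → ℤ) :
    ∃ β' : AlgebraicClosure ℚ,
      β' ^ 3 = 1 + 9 * ∑ k, (t k : AlgebraicClosure ℚ) * θ ^ (k : ℕ) ∧
      ∀ σ ∈ decomp ((Rat.HeightOneSpectrum.primesEquiv (R := 𝓞 ℚ)).symm ⟨3, Nat.prime_three⟩),
        σ • θ = θ → σ • β' = β' := by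
  haveI : Fact (Nat.Prime 3) := ⟨Nat.prime_three⟩
  set v := (Rat.HeightOneSpectrum.primesEquiv (R := 𝓞 ℚ)).symm ⟨3, Nat.prime_three⟩ with hv
  set ι := absClosureEmbedding ℚ (v.adicCompletion ℚ) with hι
  set a : AlgebraicClosure ℚ := 1 + 9 * ∑ k, (t k : AlgebraicClosure ℚ) * θ ^ (k : ℕ) with ha
  -- `ℤ₃ → ℚ₃ ≃ ℚ_v → \bar{ℚ_v}`
  let e : ℚ_[3] ≃ₐ[ℚ] v.adicCompletion ℚ := (Padic.adicCompletionEquiv (𝓞 ℚ) ⟨3, Nat.prime_three⟩).toAlgEquiv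
  let φ : ℤ_[3] →+* AlgebraicClosure (v.adicCompletion ℚ) :=
    (algebraMap (v.adicCompletion ℚ) (AlgebraicClosure (v.adicCompletion ℚ))).comp
      (e.toAlgHom.toRingHom.comp PadicInt.Coe.ringHom)
  have hφ : ∀ z : ℤ_[3],
      φ z = algebraMap (v.adicCompletion ℚ) (AlgebraicClosure (v.adicCompletion ℚ)) (e (z : ℚ_[3])) :=
    fun z ↦ rfl
  -- the table for `ι θ`
  have hT : ∀ i j : Fin n, ι θ ^ (i : ℕ) * ι θ ^ (j : ℕ) =
      ∑ k, (μ k i j : AlgebraicClosure (v.adicCompletion ℚ)) * ι θ ^ (k : ℕ) := by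
    intro i j
    have h := congrArg ι (hθ i j)
    simpa [map_mul, map_pow, map_sum, map_intCast] using h
  obtain ⟨s, hb⟩ := exists_cube_eq_of_table φ μ (ι θ) hT t
  set b : AlgebraicClosure (v.adicCompletion ℚ) := 1 + 3 * ∑ k, φ (s k) * ι θ ^ (k : ℕ) with hbdef
  have hιa : ι a = 1 + 9 * ∑ k, (t k : AlgebraicClosure (v.adicCompletion ℚ)) * ι θ ^ (k : ℕ) := by
    simp [ha, map_mul, map_pow, map_sum, map_ofNat, map_intCast]
  -- `b` is fixed by the automorphisms of `\bar{ℚ_v}/ℚ_v` fixing `ι θ`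
  have hbfix : ∀ τ : absoluteGaloisGroup (v.adicCompletion ℚ), τ • ι θ = ι θ → τ • b = b := by
    intro τ hτ
    rw [absoluteGaloisGroup.smul_def] at hτ ⊢
    have hu : ∀ z : ℤ_[3], absoluteGaloisGroup.toAlgEquiv _ τ (φ z) = φ z := fun z ↦ by
      rw [hφ]; exact AlgEquiv.commutes _ _
    rw [hbdef]
    simp only [map_add, map_mul, map_pow, map_one, map_ofNat, map_sum, hτ, hu]
  -- a cube root in `ℚ̄`
  obtain ⟨β, hβ⟩ := IsAlgClosed.exists_pow_nat_eq a (by norm_num : 0 < 3)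
  by_cases hb0 : b = 0
  · -- degenerate case `a = 0`
    have ha0 : a = 0 := by
      have e0 : ι a = ι 0 := by
        rw [hιa, ← hb, hb0, map_zero]; ring
      exact ι.injective e0
    refine ⟨0, ?_, fun σ _ _ ↦ smul_zero σ⟩
    rw [ha0]; norm_num
  · obtain ⟨ζ, hζ⟩ := HasEnoughRootsOfUnity.exists_primitiveRoot (AlgebraicClosure ℚ) 3
    have hιβ : ι β ^ 3 = b ^ 3 := by rw [← map_pow, hβ, hιa, hb]
    have hζ' : IsPrimitiveRoot (ι ζ) 3 := hζ.map_of_injective ι.injective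
    obtain ⟨j, hj, hζj⟩ := hζ'.eq_pow_of_pow_eq_one (ξ := ι β / b)
      (by rw [div_pow, hιβ, div_self (pow_ne_zero _ hb0)])
    have hιβ' : ι (ζ ^ (3 - j) * β) = b := by
      rw [map_mul, map_pow]
      have e' : ι β = ι ζ ^ j * b := by rw [hζj, div_mul_cancel₀ _ hb0]
      rw [e', ← mul_assoc, ← pow_add, Nat.sub_add_cancel hj.le, hζ'.pow_eq_one, one_mul]
    refine ⟨ζ ^ (3 - j) * β, ?_, fun σ hσ hσθ ↦ ?_⟩
    · rw [mul_pow, ← pow_mul, mul_comm (3 - j), pow_mul, hζ.pow_eq_one, one_pow, one_mul, hβ]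
    · obtain ⟨τ, rfl⟩ := hσ
      have hτT : τ • ι θ = ι θ := by
        rw [← absGaloisRestrict_apply_smul]
        exact congrArg ι hσθ
      have key : ι (absGaloisRestrict ℚ (v.adicCompletion ℚ) τ • (ζ ^ (3 - j) * β)) =
          ι (ζ ^ (3 - j) * β) := by
        rw [absGaloisRestrict_apply_smul, hιβ', hbfix τ hτT]
      exact ι.injective key

end Decomp

end KummerLayerClasses

end Summit.BirchSwinnertonDyer.Rank1Residual.Additive

end
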